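import Literature.AnabelianGeometry.EtaleTheta.ClassicalThetaValueOrders
import HarnessLib

/-!
# [IUTchIV] Remark 1.10.6 (ii): the special value of the theta series at the 2-torsion point is a unit
# for odd `p` and a nonzero non-unit for `p = 2` (PROVED, by name from the [EtTh] §1 value computations)

Mochizuki, *Inter-universal Teichmüller theory IV*, RIMS manuscript (Apr. 2020; = PRIMS **57** (2021)),
§1, Remark 1.10.6 (ii), pp. 36–38 — DAG node `IUTchIV:Rmk1.10.6(ii)` of the abc-iut cell, typed by
mention in `Literature/IUT/LogVolume/Theorem110Remarks.lean` (p405016), whose module docstring says: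
"Deliberately NOT here: Rmk 1.10.6 (ii)'s computation of the special value of the theta series at the
2-torsion point (a unit for odd `p`, a non-unit for `p = 2`) — it belongs with [EtTh] Prop. 1.4 (layer
L2)". Layer L2 has since landed that computation; this PROOF-ONLY companion (no definitions, no named
facts, nothing restated) turns the remark's one CHECKABLE sentence into kernel theorems of the
`Literature.IUT.LogVolume` namespace, citing the L2 theorems by name.

The printed text (p. 37): "(1) [constant multiple rigidity] is obtained by evaluating the usual series
for the theta function [cf. [EtTh], Proposition 1.4] at the 2-torsion point in the “irreducible
component labeled zero”. One computes easily that the resulting “special value” is a unit for odd `p`,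
but is equal to a [nonzero] non-unit when `p = 2`. In particular, since (1) is established by dividing
the series of [EtTh], Proposition 1.4 …, by this special value, it follows that (a) the “integral
structure” on the theta function determined by this special value coincides with (b) the “integral
structure” on the theta function determined by the natural integral structure on the pole at the origin
for odd `p` [cf. [EtTh], Theorem 1.10, (iii)], but not when `p = 2`. That is to say, when `p = 2`, a
nontrivial denominator arises."

Dictionary. The series is `Θ̈ = thetaDdot q̈` of `ClassicalTheta.lean`
(`Θ̈(Ü) = Σ_{n∈ℤ} (−1)^n q̈^{n(n+1)} Ü^{2n+1}`, `q̈ = q^{1/2}`, leading term `Ü` with coefficient `1` =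
"the natural integral structure on the pole at the origin"); the 2-torsion point of the irreducible
component labeled zero is `Ü = ζ` with `ζ² = −1` (`U = Ü² = −1 ∈ μ₂`, `‖ζ‖ = 1`); the special value is
`Θ̈(ζ) = ζ · Σ_{n∈ℤ} q̈^{n(n+1)} = 2ζ·(1 + q̈² + q̈⁶ + …)` (`thetaDdot_sqrt_neg_one`, L2-t1) of absolute
value `‖2‖` (`norm_thetaDdot_sqrt_neg_one`, complete ultrametric field, L6-t23;
`PadicAlgCl.norm_thetaDdot_sqrt_neg_one` in `ℚ̄_p`, the carrier of the cell's [EtTh]/[IUTch] statement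
files). "Unit" / "nonzero non-unit" are read valuation-theoretically (`x ∈ O_K^× ⟺ ‖x‖ = 1`,
`x ∈ O_K ∖ (O_K^× ∪ {0}) ⟺ 0 < ‖x‖ < 1`), and "a nontrivial denominator" as `1 < ‖Θ̈(ζ)⁻¹‖`.

What is proved (namespace `Literature.IUT.LogVolume.Rmk1106`):
* any complete ultrametric normed field, `‖q̈‖ < 1`, `ζ² = −1` (over L2's `‖Θ̈(ζ)‖ = ‖2‖`, not restated):
  `norm_specialValue_eq_one` (`‖2‖ = 1` ⇒ unit), `specialValue_ne_zero_and_norm_lt_one`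
  (`‖2‖ < 1`, `2 ≠ 0` ⇒ nonzero non-unit);
* `ℚ̄_p = PadicAlgCl p`, `‖q̈‖ < 1`, `ζ² = −1` (over L2's `PadicAlgCl.norm_thetaDdot_sqrt_neg_one`,
  `…_lt_one_iff`, `PadicAlgCl.thetaDdot_sqrt_neg_one_ne_zero`, not restated):
  `padic_norm_two_eq_one_iff` (`‖2‖ = 1 ↔ p ≠ 2`),
  `padic_norm_specialValue_eq_one_of_ne_two` (odd `p` ⇒ unit),
  `padic_specialValue_nonunit_of_eq_two` (`p = 2` ⇒ `Θ̈(ζ) ≠ 0 ∧ ‖Θ̈(ζ)‖ < 1`), the exact value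
  `padic_norm_specialValue_of_eq_two` (`= 2⁻¹`), `padic_norm_specialValue_eq_one_iff` (`↔ p ≠ 2`),
  `padic_specialValue_dichotomy` (the printed sentence as one disjunction), and the denominator of (a)
  versus (b): `padic_norm_inv_specialValue_eq_one_iff` (`‖Θ̈(ζ)⁻¹‖ = 1 ↔ p ≠ 2`),
  `padic_one_lt_norm_inv_specialValue_iff` (`1 < ‖Θ̈(ζ)⁻¹‖ ↔ p = 2`).

Deliberately NOT here: the integral structures (a)/(b) as lattices of Kummer classes ([EtTh] Thm. 1.10
(iii) is L2's `ConstantMultipleRigidity*.lean`); the multiradiality discussion ([IUTchII] Rmk. 1.12.2);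
`𝕍^bad_mod` (Rmk 1.10.6 (i), `Corollary22Statement.logQAvoid`). Classical `q`-series bookkeeping.
HONEST FRAMING: nothing here takes a side on [IUTchIII] Cor. 3.12 or asserts any disputed claim (the
series' key carries the D-0012 status, hence the tags); typed ≠ endorsed. Seat abc-iut-w5-d248 (gen 11),
campaign-S residual R1 of the abc-iut-w4-d018 S census (2026-08-27).
-/

noncomputable section

namespace Literature.IUT.LogVolume

namespace Rmk1106

open Literature.AnabelianGeometry.EtaleTheta

/-! ### Any complete ultrametric field (`K̈` a finite extension of `ℚ_p` in [EtTh] §1) -/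

section General

variable {𝕜 : Type*} [NormedField 𝕜] [CompleteSpace 𝕜] [IsUltrametricDist 𝕜] {q2 ζ : 𝕜}

/-- **"a unit for odd `p`"**: in odd residue characteristic (`‖2‖ = 1`) the special value is a unit,
`‖Θ̈(ζ)‖ = 1`. [claim: Mochizuki2012, status: disputed] -/
theorem norm_specialValue_eq_one (hζ : ζ ^ 2 = -1) (hq : ‖q2‖ < 1) (h2 : ‖(2 : 𝕜)‖ = 1) :
    ‖thetaDdot q2 ζ‖ = 1 := by
  rw [norm_thetaDdot_sqrt_neg_one hζ hq, h2]

/-- **"a [nonzero] non-unit when `p = 2`"**: in residue characteristic `2` (`‖2‖ < 1`) and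
characteristic `≠ 2` (`2 ≠ 0`) the special value is nonzero of absolute value `< 1`.
[claim: Mochizuki2012, status: disputed] -/
theorem specialValue_ne_zero_and_norm_lt_one (hζ : ζ ^ 2 = -1) (hq : ‖q2‖ < 1)
    (h2 : ‖(2 : 𝕜)‖ < 1) (h2' : (2 : 𝕜) ≠ 0) : thetaDdot q2 ζ ≠ 0 ∧ ‖thetaDdot q2 ζ‖ < 1 := by
  refine ⟨?_, ?_⟩
  · rw [← norm_pos_iff, norm_thetaDdot_sqrt_neg_one hζ hq, norm_pos_iff]
    exact h2'
  · rw [norm_thetaDdot_sqrt_neg_one hζ hq]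
    exact h2

end General

/-! ### In `ℚ̄_p` (`PadicAlgCl p`), by the prime `p` -/

section Padic

variable {p : ℕ} [Fact p.Prime] {q2 ζ : PadicAlgCl p}

/-- `‖2‖ = 2⁻¹ < 1` in `ℚ̄_2` and `‖2‖ = 1` in `ℚ̄_p` for odd `p`: `‖2‖ = 1 ↔ p ≠ 2` (from L6-t23's
`PadicAlgCl.norm_two_lt_one_iff` and `‖n‖ ≤ 1`). [cite: NeukirchSchmidtWingberg2008, II §5] -/
theorem padic_norm_two_eq_one_iff : ‖(2 : PadicAlgCl p)‖ = 1 ↔ p ≠ 2 := by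
  have hle : ‖(2 : PadicAlgCl p)‖ ≤ 1 := by
    simpa using IsUltrametricDist.norm_natCast_le_one (PadicAlgCl p) 2
  constructor
  · intro h hp
    have hlt := (PadicAlgCl.norm_two_lt_one_iff (p := p)).mpr hp
    rw [h] at hlt
    exact lt_irrefl _ hlt
  · intro hp
    exact le_antisymm hle (not_lt.mp fun h => hp (PadicAlgCl.norm_two_lt_one_iff.mp h))

/-- `‖2‖ = 2⁻¹` in `ℚ̄_2` (`‖p‖_p = p⁻¹` extends to `ℚ̄_p`). [cite: NeukirchSchmidtWingberg2008, II §5] -/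
theorem padic_norm_two_of_eq_two (hp : p = 2) : ‖(2 : PadicAlgCl p)‖ = 2⁻¹ := by
  subst hp
  rw [show (2 : PadicAlgCl 2) = ((2 : ℕ) : PadicAlgCl 2) by norm_cast,
    ← map_natCast (algebraMap ℚ_[2] (PadicAlgCl 2)) 2]
  change ‖(((2 : ℕ) : ℚ_[2]) : PadicAlgCl 2)‖ = _
  rw [PadicAlgCl.norm_extends 2, Padic.norm_p]
  norm_num

/-- **Rmk 1.10.6 (ii), odd `p`**: "the resulting “special value” is a unit for odd `p`" —
`‖Θ̈(ζ)‖ = 1` for `p ≠ 2`. [claim: Mochizuki2012, status: disputed] -/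
theorem padic_norm_specialValue_eq_one_of_ne_two (hζ : ζ ^ 2 = -1) (hq : ‖q2‖ < 1) (hp : p ≠ 2) :
    ‖thetaDdot q2 ζ‖ = 1 := by
  rw [PadicAlgCl.norm_thetaDdot_sqrt_neg_one hζ hq, padic_norm_two_eq_one_iff.mpr hp]

/-- **Rmk 1.10.6 (ii), `p = 2`**: "… but is equal to a [nonzero] non-unit when `p = 2`" —
`Θ̈(ζ) ≠ 0` and `‖Θ̈(ζ)‖ < 1`. [claim: Mochizuki2012, status: disputed] -/
theorem padic_specialValue_nonunit_of_eq_two (hζ : ζ ^ 2 = -1) (hq : ‖q2‖ < 1) (hp : p = 2) :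
    thetaDdot q2 ζ ≠ 0 ∧ ‖thetaDdot q2 ζ‖ < 1 :=
  ⟨PadicAlgCl.thetaDdot_sqrt_neg_one_ne_zero hζ hq, (PadicAlgCl.norm_thetaDdot_sqrt_neg_one_lt_one_iff hζ hq).mpr hp⟩

/-- The non-unit at `p = 2`, exactly: `‖Θ̈(ζ)‖ = 2⁻¹` in `ℚ̄_2` (valuation `1`: `Θ̈(ζ) = 2·ζ·(1-unit)`).
[claim: Mochizuki2012, status: disputed] -/
theorem padic_norm_specialValue_of_eq_two (hζ : ζ ^ 2 = -1) (hq : ‖q2‖ < 1) (hp : p = 2) :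
    ‖thetaDdot q2 ζ‖ = 2⁻¹ := by
  rw [PadicAlgCl.norm_thetaDdot_sqrt_neg_one hζ hq, padic_norm_two_of_eq_two hp]

/-- **Unit iff `p` odd**: `‖Θ̈(ζ)‖ = 1 ↔ p ≠ 2`. [claim: Mochizuki2012, status: disputed] -/
theorem padic_norm_specialValue_eq_one_iff (hζ : ζ ^ 2 = -1) (hq : ‖q2‖ < 1) :
    ‖thetaDdot q2 ζ‖ = 1 ↔ p ≠ 2 := by
  rw [PadicAlgCl.norm_thetaDdot_sqrt_neg_one hζ hq, padic_norm_two_eq_one_iff]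

/-- **Rmk 1.10.6 (ii) as printed, in one sentence**: the special value is a unit for odd `p`, and a
nonzero non-unit for `p = 2`. [claim: Mochizuki2012, status: disputed] -/
theorem padic_specialValue_dichotomy (hζ : ζ ^ 2 = -1) (hq : ‖q2‖ < 1) :
    (p ≠ 2 ∧ ‖thetaDdot q2 ζ‖ = 1) ∨ (p = 2 ∧ thetaDdot q2 ζ ≠ 0 ∧ ‖thetaDdot q2 ζ‖ < 1) := by
  by_cases hp : p = 2
  · exact Or.inr ⟨hp, padic_specialValue_nonunit_of_eq_two hζ hq hp⟩
  · exact Or.inl ⟨hp, padic_norm_specialValue_eq_one_of_ne_two hζ hq hp⟩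

/-! ### "(a) coincides with (b) for odd `p` … when `p = 2`, a nontrivial denominator arises"

Integral structure (a) is obtained from (b) (the series `Θ̈` itself) by "dividing the series … by this
special value"; the divisor `Θ̈(ζ)` — equivalently the factor `Θ̈(ζ)⁻¹` — is a unit exactly for odd `p`. -/

/-- The factor carrying (b) to (a): `‖Θ̈(ζ)⁻¹‖ = ‖2‖⁻¹`. [claim: Mochizuki2012, status: disputed] -/
theorem padic_norm_inv_specialValue (hζ : ζ ^ 2 = -1) (hq : ‖q2‖ < 1) :
    ‖(thetaDdot q2 ζ)⁻¹‖ = ‖(2 : PadicAlgCl p)‖⁻¹ := by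
  rw [norm_inv, PadicAlgCl.norm_thetaDdot_sqrt_neg_one hζ hq]

/-- **(a) = (b) for odd `p`**: the factor `Θ̈(ζ)⁻¹` is a unit iff `p ≠ 2`.
[claim: Mochizuki2012, status: disputed] -/
theorem padic_norm_inv_specialValue_eq_one_iff (hζ : ζ ^ 2 = -1) (hq : ‖q2‖ < 1) :
    ‖(thetaDdot q2 ζ)⁻¹‖ = 1 ↔ p ≠ 2 := by
  rw [norm_inv, inv_eq_one, padic_norm_specialValue_eq_one_iff hζ hq]

/-- **"when `p = 2`, a nontrivial denominator arises"**: `1 < ‖Θ̈(ζ)⁻¹‖ ↔ p = 2` (and then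
`‖Θ̈(ζ)⁻¹‖ = 2`). [claim: Mochizuki2012, status: disputed] -/
theorem padic_one_lt_norm_inv_specialValue_iff (hζ : ζ ^ 2 = -1) (hq : ‖q2‖ < 1) :
    1 < ‖(thetaDdot q2 ζ)⁻¹‖ ↔ p = 2 := by
  rw [norm_inv, one_lt_inv₀ (norm_pos_iff.mpr (PadicAlgCl.thetaDdot_sqrt_neg_one_ne_zero hζ hq)),
    PadicAlgCl.norm_thetaDdot_sqrt_neg_one_lt_one_iff hζ hq]

/-- The denominator at `p = 2`, exactly: `‖Θ̈(ζ)⁻¹‖ = 2` in `ℚ̄_2`. [claim: Mochizuki2012, status: disputed] -/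
theorem padic_norm_inv_specialValue_of_eq_two (hζ : ζ ^ 2 = -1) (hq : ‖q2‖ < 1) (hp : p = 2) :
    ‖(thetaDdot q2 ζ)⁻¹‖ = 2 := by
  rw [norm_inv, padic_norm_specialValue_of_eq_two hζ hq hp, inv_inv]

end Padic

end Rmk1106

end Literature.IUT.LogVolume

end
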